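import Mathlib

/-!
# Nodal propagator decay (route `NodalWardXY`, item `NodalPropagatorDecay`): III. lattice geometry

The d-wave BdG data of the item, `ξ(p) = -2(cos p₁ + cos p₂) - μ`, `Δ(p) = 2Δ₀(cos p₁ - cos p₂)`,
`E = √(ξ² + Δ²)`, for `μ ∈ (-4, 4)`, `Δ₀ > 0`; nodes at `cos p₁ = cos p₂ = -μ/4 =: cos n₀`,
`n₀ = arccos(-μ/4) ∈ (0, π)`.  Three elementary facts (no definitions):

* `abs_cos_sub_cos_ge`: `|cos θ - cos n₀| ≥ κ · ||θ| - n₀|` on `|θ| ≤ π` (`κ = κ(n₀) > 0`);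
* `bdg_energy_ge`: the conical lower bound `E(p) ≥ 2 min(1,Δ₀) (|cos p₁ + μ/4| + |cos p₂ + μ/4|)`;
* `bdg_line_profile`: on a momentum line `p₂ = const` off the nodal values, all three Nambu
  components `e^{-|τ|E}·(1, ξ/E, Δ/E)` equal the universal profile
  `e^{-lρ(s)}(γ + (α + βs)/ρ(s))`, `ρ = √(1+s²)`, at `s = a cos p₁ + b`, with `l ≥ 0`,
  `|α|, |β|, |γ| ≤ 1` and `a = (1 + Δ₀²)/(2Δ₀ |cos p₂ + μ/4|)` (the line `{(ξ,Δ)}` is straight, at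
  distance `∝ |cos p₂ + μ/4|` from the origin).
-/

noncomputable section

namespace Summit.HubbardSuperconductivity.HubbardSuperconductivity.Theorems

namespace NodalDecay

open Real

local notation "ρ⟪" s "⟫" => Real.sqrt (1 + s ^ 2)
local notation "P0⟪" l ", " s "⟫" => Real.exp (-(l * ρ⟪s⟫))
local notation "Q0⟪" α ", " β ", " γ ", " s "⟫" => γ + (α + β * s) / ρ⟪s⟫
local notation "prof⟪" l ", " α ", " β ", " γ ", " s "⟫" => P0⟪l, s⟫ * Q0⟪α, β, γ, s⟫

/-! ### The node angle and the cosine-difference bound -/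

/-- For `n₀ ∈ (0, π)` there is `κ > 0` with `κ · ||θ| - n₀| ≤ |cos θ - cos n₀|` for `|θ| ≤ π`. -/
theorem abs_cos_sub_cos_ge {n₀ : ℝ} (h0 : 0 < n₀) (hπ : n₀ < π) :
    ∃ κ : ℝ, 0 < κ ∧ ∀ θ : ℝ, |θ| ≤ π → κ * |(|θ| - n₀)| ≤ |Real.cos θ - Real.cos n₀| := by
  -- m = min (sin (n₀/2), cos (n₀/2)) bounds sin ((t + n₀)/2) from below for t ∈ [0, π]
  set m : ℝ := min (Real.sin (n₀ / 2)) (Real.cos (n₀ / 2)) with hm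
  have hm_pos : 0 < m := by
    apply lt_min
    · exact Real.sin_pos_of_pos_of_lt_pi (by linarith) (by linarith)
    · exact Real.cos_pos_of_mem_Ioo ⟨by linarith, by linarith⟩
  refine ⟨2 * m / π, by positivity, ?_⟩
  intro θ hθ
  -- reduce to t = |θ| ∈ [0, π]
  rw [show Real.cos θ = Real.cos |θ| by rw [Real.cos_abs]]
  set t := |θ| with ht
  have ht0 : 0 ≤ t := abs_nonneg θ
  -- product formula
  rw [Real.cos_sub_cos, abs_mul, abs_mul, abs_neg, show |(2:ℝ)| = 2 by norm_num]
  -- lower bound for |sin ((t + n₀)/2)|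
  have hA : m ≤ |Real.sin ((t + n₀) / 2)| := by
    have hy0 : n₀ / 2 ≤ (t + n₀) / 2 := by linarith
    have hy1 : (t + n₀) / 2 ≤ (π + n₀) / 2 := by linarith
    rcases le_or_gt ((t + n₀) / 2) (π / 2) with hle | hlt
    · have := Real.sin_le_sin_of_le_of_le_pi_div_two (by linarith) hle hy0
      rw [abs_of_nonneg (Real.sin_nonneg_of_nonneg_of_le_pi (by linarith) (by linarith))]
      exact (min_le_left _ _).trans this
    · have e : Real.sin ((t + n₀) / 2) = Real.sin (π - (t + n₀) / 2) := by rw [Real.sin_pi_sub]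
      have e2 : Real.cos (n₀ / 2) = Real.sin (π / 2 - n₀ / 2) := by rw [Real.sin_pi_div_two_sub]
      rw [e, abs_of_nonneg (Real.sin_nonneg_of_nonneg_of_le_pi (by linarith) (by linarith))]
      refine (min_le_right _ _).trans ?_
      rw [e2]
      exact Real.sin_le_sin_of_le_of_le_pi_div_two (by linarith) (by linarith) (by linarith)
  -- Jordan for |sin ((t - n₀)/2)|
  have hB : |t - n₀| / π ≤ |Real.sin ((t - n₀) / 2)| := by
    have key : ∀ v : ℝ, 0 ≤ v → v ≤ π / 2 → 2 / π * v ≤ |Real.sin v| :=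
      fun v h1 h2 => (Real.mul_le_sin h1 h2).trans (le_abs_self _)
    have hle : |t - n₀| ≤ π := by rw [abs_le]; constructor <;> linarith
    rcases le_or_gt 0 (t - n₀) with hv | hv
    · have h := key ((t - n₀) / 2) (by linarith) (by linarith)
      rw [abs_of_nonneg hv]
      calc (t - n₀) / π = 2 / π * ((t - n₀) / 2) := by field_simp
        _ ≤ _ := h
    · have h := key (-((t - n₀) / 2)) (by linarith) (by rw [abs_of_neg hv] at hle; linarith)
      rw [Real.sin_neg, abs_neg] at h
      rw [abs_of_neg hv]
      calc -(t - n₀) / π = 2 / π * (-((t - n₀) / 2)) := by field_simp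
        _ ≤ _ := h
  calc 2 * m / π * |t - n₀| = 2 * m * (|t - n₀| / π) := by ring
    _ ≤ 2 * |Real.sin ((t + n₀) / 2)| * |Real.sin ((t - n₀) / 2)| := by
        have := Real.pi_pos
        gcongr

/-! ### The conical lower bound for `E` -/

/-- `E(p) = √(ξ² + Δ²) ≥ 2 min(1, Δ₀) (|cos p₁ + μ/4| + |cos p₂ + μ/4|)`. -/
theorem bdg_energy_ge (μ Δ₀ : ℝ) (hΔ : 0 ≤ Δ₀) (p₁ p₂ : ℝ) :
    2 * min 1 Δ₀ * (|Real.cos p₁ + μ / 4| + |Real.cos p₂ + μ / 4|) ≤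
      Real.sqrt ((-2 * (Real.cos p₁ + Real.cos p₂) - μ) ^ 2
        + (2 * Δ₀ * (Real.cos p₁ - Real.cos p₂)) ^ 2) := by
  set A := Real.cos p₁ + μ / 4
  set B := Real.cos p₂ + μ / 4
  set d := min 1 Δ₀ with hd
  have hd0 : 0 ≤ d := le_min zero_le_one hΔ
  have hd1 : d ≤ 1 := min_le_left _ _
  have hdΔ : d ≤ Δ₀ := min_le_right _ _
  have hξ : -2 * (Real.cos p₁ + Real.cos p₂) - μ = -2 * (A + B) := by simp only [A, B]; ring
  have hΔ' : 2 * Δ₀ * (Real.cos p₁ - Real.cos p₂) = 2 * Δ₀ * (A - B) := by simp only [A, B]; ring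
  rw [hξ, hΔ']
  apply Real.le_sqrt_of_sq_le
  have hA := abs_nonneg A; have hB := abs_nonneg B
  have e1 : (2 * d * (|A| + |B|)) ^ 2 = 4 * d ^ 2 * (A ^ 2 + B ^ 2) + 8 * d ^ 2 * (|A| * |B|) := by
    have := sq_abs A; have := sq_abs B; nlinarith
  have e2 : 2 * (|A| * |B|) ≤ A ^ 2 + B ^ 2 := by
    have := sq_abs A; have := sq_abs B; nlinarith [sq_nonneg (|A| - |B|)]
  have hd2 : d ^ 2 ≤ 1 := by nlinarith
  have hd3 : d ^ 2 ≤ Δ₀ ^ 2 := by nlinarith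
  calc (2 * d * (|A| + |B|)) ^ 2 ≤ 8 * d ^ 2 * (A ^ 2 + B ^ 2) := by nlinarith [sq_nonneg d]
    _ = 4 * d ^ 2 * (A + B) ^ 2 + 4 * d ^ 2 * (A - B) ^ 2 := by ring
    _ ≤ 4 * 1 * (A + B) ^ 2 + 4 * Δ₀ ^ 2 * (A - B) ^ 2 := by
        gcongr
    _ = (-2 * (A + B)) ^ 2 + (2 * Δ₀ * (A - B)) ^ 2 := by ring

/-! ### The momentum line `p₂ = const` and the universal profile -/

/-- **Line identity.**  Fix `μ`, `Δ₀ > 0`, `τ`, and `p₂` with `cos p₂ + μ/4 ≠ 0` (a non-nodal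
momentum line).  Then there are `l ≥ 0`, coefficients `|α₁|, |β₁|, |α₂|, |β₂| ≤ 1`, and an affine
reparametrisation `s = a cos p₁ + b` with `a = (1 + Δ₀²) / (2Δ₀ |cos p₂ + μ/4|) > 0` such that for
every `p₁`, writing `ξ, Δ, E` for the BdG data of the item,
`e^{-|τ|E} = P0⟪l, s⟫`, `e^{-|τ|E} ξ/E = prof⟪l, α₁, β₁, 0, s⟫`, `e^{-|τ|E} Δ/E = prof⟪l, α₂, β₂, 0, s⟫`. -/
theorem bdg_line_profile (μ Δ₀ τ p₂ : ℝ) (hΔ : 0 < Δ₀) (hc : Real.cos p₂ + μ / 4 ≠ 0) :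
    ∃ l α₁ β₁ α₂ β₂ a b : ℝ, 0 ≤ l ∧ |α₁| ≤ 1 ∧ |β₁| ≤ 1 ∧ |α₂| ≤ 1 ∧ |β₂| ≤ 1 ∧ 0 < a ∧
      a = (1 + Δ₀ ^ 2) / (2 * Δ₀ * |Real.cos p₂ + μ / 4|) ∧
      ∀ p₁ : ℝ,
        Real.exp (-|τ| * Real.sqrt ((-2 * (Real.cos p₁ + Real.cos p₂) - μ) ^ 2
            + (2 * Δ₀ * (Real.cos p₁ - Real.cos p₂)) ^ 2)) = P0⟪l, a * Real.cos p₁ + b⟫ ∧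
        Real.exp (-|τ| * Real.sqrt ((-2 * (Real.cos p₁ + Real.cos p₂) - μ) ^ 2
            + (2 * Δ₀ * (Real.cos p₁ - Real.cos p₂)) ^ 2))
          * ((-2 * (Real.cos p₁ + Real.cos p₂) - μ)
            / Real.sqrt ((-2 * (Real.cos p₁ + Real.cos p₂) - μ) ^ 2
              + (2 * Δ₀ * (Real.cos p₁ - Real.cos p₂)) ^ 2))
          = prof⟪l, α₁, β₁, 0, a * Real.cos p₁ + b⟫ ∧
        Real.exp (-|τ| * Real.sqrt ((-2 * (Real.cos p₁ + Real.cos p₂) - μ) ^ 2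
            + (2 * Δ₀ * (Real.cos p₁ - Real.cos p₂)) ^ 2))
          * ((2 * Δ₀ * (Real.cos p₁ - Real.cos p₂))
            / Real.sqrt ((-2 * (Real.cos p₁ + Real.cos p₂) - μ) ^ 2
              + (2 * Δ₀ * (Real.cos p₁ - Real.cos p₂)) ^ 2))
          = prof⟪l, α₂, β₂, 0, a * Real.cos p₁ + b⟫ := by
  -- notation: c = cos p₂ + μ/4 (signed distance parameter), K = 1 + Δ₀², rK = √K
  set c := Real.cos p₂ + μ / 4 with hc_def
  set K := 1 + Δ₀ ^ 2 with hK
  have hKpos : 0 < K := by positivity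
  set rK := Real.sqrt K with hrK
  have hrKpos : 0 < rK := Real.sqrt_pos.2 hKpos
  have hrK2 : rK ^ 2 = K := Real.sq_sqrt hKpos.le
  have hrK1 : 1 ≤ rK := by
    rw [hrK]; apply Real.le_sqrt_of_sq_le; rw [hK]; nlinarith [sq_nonneg Δ₀]
  have hΔrK : Δ₀ ≤ rK := by
    rw [hrK]; apply Real.le_sqrt_of_sq_le; rw [hK]; nlinarith
  -- the sign ε of c
  obtain ⟨ε, hε, hεc⟩ : ∃ ε : ℝ, (ε = 1 ∨ ε = -1) ∧ |c| = ε * c := by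
    rcases le_or_gt 0 c with h | h
    · exact ⟨1, Or.inl rfl, by rw [abs_of_nonneg h, one_mul]⟩
    · exact ⟨-1, Or.inr rfl, by rw [abs_of_neg h]; ring⟩
  have hε2 : ε ^ 2 = 1 := by rcases hε with h | h <;> simp [h]
  have hεabs : |ε| = 1 := by rcases hε with h | h <;> simp [h]
  have hcpos : 0 < ε * c := by rw [← hεc]; exact abs_pos.2 hc
  -- the data
  set a : ℝ := K / (2 * Δ₀ * (ε * c)) with ha
  set t₀ : ℝ := -(2 * Real.cos p₂ * (1 - Δ₀ ^ 2) + μ) / (2 * K) with ht₀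
  set M : ℝ := 4 * Δ₀ * (ε * c) / rK with hM
  have hMpos : 0 < M := by positivity
  have hapos : 0 < a := by positivity
  refine ⟨|τ| * M, -ε * Δ₀ / rK, -1 / rK, -ε / rK, Δ₀ / rK, a, -(a * t₀), by positivity,
    ?_, ?_, ?_, ?_, hapos, ?_, ?_⟩
  · rw [abs_div, abs_mul, abs_neg, hεabs, one_mul, abs_of_pos hΔ, abs_of_pos hrKpos,
      div_le_one hrKpos]; exact hΔrK
  · rw [abs_div, abs_neg, abs_one, abs_of_pos hrKpos, div_le_one hrKpos]; exact hrK1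
  · rw [abs_div, abs_neg, hεabs, abs_of_pos hrKpos, div_le_one hrKpos]; exact hrK1
  · rw [abs_div, abs_of_pos hΔ, abs_of_pos hrKpos, div_le_one hrKpos]; exact hΔrK
  · rw [ha, hεc.symm]
  intro p₁
  set u := Real.cos p₁ with hu
  set S := a * u + -(a * t₀) with hS
  have hS' : S = a * (u - t₀) := by rw [hS]; ring
  -- the BdG data in terms of c
  set ξ := -2 * (u + Real.cos p₂) - μ with hξ
  set Δ := 2 * Δ₀ * (u - Real.cos p₂) with hΔ'
  have hcne : ε * c ≠ 0 := hcpos.ne'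
  have hΔne : Δ₀ ≠ 0 := hΔ.ne'
  have hrKne : rK ≠ 0 := hrKpos.ne'
  have hK0 : (1 + Δ₀ ^ 2 : ℝ) ≠ 0 := by positivity
  have hε0 : ε ≠ 0 := by rcases hε with h | h <;> simp [h]
  have hc0 : c ≠ 0 := hc
  have hw : Real.cos p₂ = c - μ / 4 := by rw [hc_def]; ring
  have hMK : M / rK = 4 * Δ₀ * (ε * c) / K := by
    rw [hM, div_div, ← sq, hrK2]
  have hM2 : M ^ 2 = 16 * Δ₀ ^ 2 * (ε * c) ^ 2 / K := by
    rw [hM, div_pow, hrK2]; ring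
  -- (L1) ξ = M (α₁ + β₁ S), (L2) Δ = M (α₂ + β₂ S), (P) ξ² + Δ² = M² (1 + S²)
  have L1 : ξ = M * (-ε * Δ₀ / rK + -1 / rK * S) := by
    have e : M * (-ε * Δ₀ / rK + -1 / rK * S) = (M / rK) * (-(ε * Δ₀) - S) := by ring
    rw [e, hMK, hS', ha, ht₀, hξ, hw, hK]
    field_simp
    rcases hε with h | h <;> · subst h; ring
  have L2 : Δ = M * (-ε / rK + Δ₀ / rK * S) := by
    have e : M * (-ε / rK + Δ₀ / rK * S) = (M / rK) * (-ε + Δ₀ * S) := by ring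
    rw [e, hMK, hS', ha, ht₀, hΔ', hw, hK]
    field_simp
    rcases hε with h | h <;> · subst h; ring
  have P : ξ ^ 2 + Δ ^ 2 = M ^ 2 * (1 + S ^ 2) := by
    rw [hM2, hS', ha, ht₀, hξ, hΔ', hw, hK]
    field_simp
    rcases hε with h | h <;> · subst h; ring
  have hE : Real.sqrt (ξ ^ 2 + Δ ^ 2) = M * ρ⟪S⟫ := by
    rw [P, Real.sqrt_mul' _ (by positivity), Real.sqrt_sq hMpos.le]
  have hexp : Real.exp (-|τ| * (M * ρ⟪S⟫)) = P0⟪|τ| * M, S⟫ := by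
    congr 1; ring
  have hρ : (0:ℝ) < ρ⟪S⟫ := Real.sqrt_pos.2 (by positivity)
  refine ⟨?_, ?_, ?_⟩
  · rw [hE, hexp]
  · rw [hE, hexp]
    conv_lhs => rw [L1]
    rw [mul_div_mul_left _ _ hMpos.ne', zero_add]
  · rw [hE, hexp]
    conv_lhs => rw [L2]
    rw [mul_div_mul_left _ _ hMpos.ne', zero_add]

end NodalDecay

end Summit.HubbardSuperconductivity.HubbardSuperconductivity.Theorems
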